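import Summits.QuantumFields.YangMills.Theorems.BalabanLadderIRAbstractBasinRung24
import Summits.QuantumFields.YangMills.Theorems.BalabanLadderIRCouplingAxisTransport
import HarnessLib

/-!
# Scaling heredity of purity along the RG diagonal — helper for crux `BalabanLadder.IR` (stmt-QuantumFields-19354), token **E**

Sorry-free part of LINE «scaling-heredity» (`Cruxes/IR/Lines/scaling_heredity.lean`; ideator seat ym-ir-idea-14 gen 2, lens
«strengthen-to-induct» / «assume no gap»; critics ym-ir-crit-1 / ym-ir-crit-2 PASS-WITH-PRICE 2026-08-28T05:35Z / 05:32Z,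
«seams → g9-№2 lane»; crit-1's optional sharpening — the scale factor `s` as a parameter — is adopted here).
HONESTY: nothing in this file proves the Clay Yang–Mills mass gap, a lattice gap, an exit or `BalabanLadder.IR`; `R4`
(`BalabanUVStability4`) closes only the conditional finite-𝕋⁴ rung `BalabanLadder.UV`.  This file re-types token **E**
(`ColdExitAt (1/24)`, one 96 %-pure cold `4:1` torus per weak coupling) of the proved bill `E → X → N → IR`
(`BasinRung.IR_of_exitAt24`) as an INDUCTION ALONG THE RENORMALISATION-GROUP DIAGONAL of the `(β, log L)` plane and
discharges no Yang–Mills content: the statements `ScalingHeredityAt`, `CofinalExitAt`, `UpwardExitHereditySC` are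
HYPOTHESES of the theorems below, never asserted.

* `ScalingHereditySC` (**OH**, the LOAD, new): one ultra-pure COARSE coupling `β` (defect `≤ 2⁻²⁵` at every scale `≥ L`)
  forces every FINER coupling one bracket up, `β' ∈ [β+Δ, β+2Δ]`, to be 96 %-pure at the `s`-fold scale `sL` (registered `s = 4`) — with
  `Δ`, `L₁`, `β₂` uniform in `β`.  Continuum-scaling covariance of purity, one cutoff-octave at a time.
* `CofinalExitAt (1/24)` (**K1**, verbatim the `ExitsUnboundedAt (1/24)` of line «coupling-clopen», shared): cofinally in
  `β`, ONE cold torus of side `≥ 8` is 96 %-pure.  THE NUMBER, asked only cofinally.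
* PROVED seams: `deep_of_le24` (exit `≤ 1/24` ⇒ defect `≤ 2⁻²⁵` at all large scales: landed basin `abstractBasin_24_epsStar`
  + landed decay `CouplingAxis.decay_of_exit`), `upward_of_scaling : OH → OH_E`, the window induction
  `coldExitAt_of_upward : OH_E → K1 → ColdExitAt (1/24)`, the exact re-cut `recut_iff : (OH_E ∧ K1) ↔ ColdExitAt (1/24)`
  (the critics' K-probe, delivered here: the scale-free shadow `OH_E` of OH is an exact re-cut of E; OH's surplus over it
  is the SCALE LAW `onset(β') ≤ s·onset(β)`), and `IR_of : OH → K1 → X → N → IR` concluding the crux BY NAME.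
* No `sorry`, no new axioms.
-/

open MeasureTheory Filter Topology
open Literature.MathematicalPhysics.QuantumFieldTheory Literature.MathematicalPhysics.QuantumLattice
open Summit.QuantumFields.YangMills.Cruxes.IR.ColdPressurePincer
open Summit.QuantumFields.YangMills.Cruxes.IR.ColdPurityBridge
open Summit.QuantumFields.YangMills.Cruxes.IR.AspectBootstrap
open Summit.QuantumFields.YangMills.Cruxes.IR.BasinRung
open Summit.QuantumFields.YangMills.Cruxes.IR.CouplingAxis (decay_of_exit)

namespace Summit.QuantumFields.YangMills.Cruxes.IR.ScalingHeredity

/-! ## §1 Statements -/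

/-- **OH = `ScalingHeredityAt η θ s`** (registered at `η = 2⁻²⁵`, `θ = 1/24`, scale factor `s = 4`).  For every
simply-connected compact simple `G` and lattice representation `r` there are a threshold `β₂`, a bracket width `Δ > 0` and
a base scale `L₁` such that: if the COARSER coupling `β ≥ β₂` is ultra-pure (`δᶜ_β(L'') ≤ η`) at EVERY scale `L'' ≥ L`
(`L ≥ L₁`), then every FINER coupling `β' ∈ [β + Δ, β + 2Δ]` is `θ`-pure at the `s`-fold scale: `δᶜ_{β'}(sL) ≤ θ`.
Physics: `a(β)/a(β') ∈ (1, s]` on the bracket when `2Δ ≤ Δ₀ log₂ s` (`Δ₀` = the coupling increment that halves the lattice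
spacing), so the `β'`-torus of side `sL` is, in physical units, a `β`-torus of side in `[L, sL)` up to cutoff effects;
Δ, L₁ UNIFORM in β is the content (scaling law `onset(β') ≤ s·max(L₁, onset(β))`).  Vacuous for `U(1)` (no coarse
coupling beyond `β_c` is ever ultra-pure at all scales) and for centre-blind actions; fails near a phase transition, whence
`β₂`.  The scale factor is a parameter at critic ym-ir-crit-1's request: the seams below hold for every `s ≥ 1`, and the
instrumentable GUIDANCE face is `s`-dependent. -/
def ScalingHeredityAt (η θ : ℝ) (s : ℕ) : Prop :=
  ∀ (G : Type) [Group G] [TopologicalSpace G] [IsTopologicalGroup G] [CompactSpace G],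
    IsCompactSimpleLieGroup G → SimplyConnectedSpace G →
    letI : MeasurableSpace G := borel G; haveI : BorelSpace G := ⟨rfl⟩;
    ∀ r : LatticeRep G, ∃ β₂ Δ : ℝ, ∃ L₁ : ℕ, 0 < Δ ∧ ∀ β : ℝ, β₂ ≤ β → ∀ L : ℕ, L₁ ≤ L →
      (∀ L'' : ℕ, L ≤ L'' → coldDefect r.ρ β L'' ≤ η) →
      ∀ β' : ℝ, β + Δ ≤ β' → β' ≤ β + 2 * Δ → coldDefect r.ρ β' (s * L) ≤ θ

/-- The registered instance **OH** := `ScalingHeredityAt 2⁻²⁵ (1/24) 4`. -/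
def ScalingHereditySC : Prop := ScalingHeredityAt (1 / 2 ^ 25) (1 / 24) 4

/-- **OH♯** — the finite-`L`-visible face: the hypothesis is asked only on the three octaves `[L, 4L]` (one RG step's worth);
`sharp_imp : OH♯ → OH`.  This is the form a Monte-Carlo falsifier tests. -/
def ScalingHereditySharp : Prop :=
  ∀ (G : Type) [Group G] [TopologicalSpace G] [IsTopologicalGroup G] [CompactSpace G],
    IsCompactSimpleLieGroup G → SimplyConnectedSpace G →
    letI : MeasurableSpace G := borel G; haveI : BorelSpace G := ⟨rfl⟩;
    ∀ r : LatticeRep G, ∃ β₂ Δ : ℝ, ∃ L₁ : ℕ, 0 < Δ ∧ ∀ β : ℝ, β₂ ≤ β → ∀ L : ℕ, L₁ ≤ L →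
      (∀ L'' : ℕ, L ≤ L'' → L'' ≤ 4 * L → coldDefect r.ρ β L'' ≤ 1 / 2 ^ 25) →
      ∀ β' : ℝ, β + Δ ≤ β' → β' ≤ β + 2 * Δ → coldDefect r.ρ β' (4 * L) ≤ 1 / 24

/-- **K1 = `CofinalExitAt θ`** — verbatim `CouplingClopen.ExitsUnboundedAt θ` (line «coupling-clopen», stub registered there
at `θ = 1/24`; re-asking attaches): cofinally in `β`, ONE cold `4:1` torus of side `≥ 8` has defect `≤ θ`. -/
def CofinalExitAt (θ : ℝ) : Prop :=
  ∀ (G : Type) [Group G] [TopologicalSpace G] [IsTopologicalGroup G] [CompactSpace G],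
    IsCompactSimpleLieGroup G → SimplyConnectedSpace G →
    letI : MeasurableSpace G := borel G; haveI : BorelSpace G := ⟨rfl⟩;
    ∀ r : LatticeRep G, ∀ β₁ : ℝ, ∃ β : ℝ, β₁ ≤ β ∧ ∃ L : ℕ, 8 ≤ L ∧ coldDefect r.ρ β L ≤ θ

/-- **OH_E = `UpwardExitHereditySC`** — the SCALE-FREE shadow of OH: an exit (`≤ 1/24`, side `≥ 8`) at a coupling `β ≥ β₂`
forces an exit at every `β' ∈ [β+Δ, β+2Δ]`.  `recut_iff`: `OH_E ∧ K1 ↔ E(1/24)` — an exact re-cut, recorded so that the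
critics' K-probe is answered in the file: OH's surplus over OH_E is the scale law, nothing else. -/
def UpwardExitHereditySC : Prop :=
  ∀ (G : Type) [Group G] [TopologicalSpace G] [IsTopologicalGroup G] [CompactSpace G],
    IsCompactSimpleLieGroup G → SimplyConnectedSpace G →
    letI : MeasurableSpace G := borel G; haveI : BorelSpace G := ⟨rfl⟩;
    ∀ r : LatticeRep G, ∃ β₂ Δ : ℝ, 0 < Δ ∧ ∀ β : ℝ, β₂ ≤ β →
      (∃ L : ℕ, 8 ≤ L ∧ coldDefect r.ρ β L ≤ 1 / 24) →
      ∀ β' : ℝ, β + Δ ≤ β' → β' ≤ β + 2 * Δ → ∃ L' : ℕ, 8 ≤ L' ∧ coldDefect r.ρ β' L' ≤ 1 / 24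

/-! ## §2 The pointwise seam: an exit at `1/24` makes the coupling ultra-pure at all large scales (PROVED) -/

section Model

variable {G : Type} [Group G] [TopologicalSpace G] [IsTopologicalGroup G] [CompactSpace G]
  [MeasurableSpace G] [BorelSpace G]

/-- `e⁻⁴ ≤ 1/32`. -/
theorem exp_neg_four_le : Real.exp (-4) ≤ 1 / 32 := by
  rw [Real.exp_neg, one_div]
  apply inv_anti₀ (by norm_num : (0 : ℝ) < 32)
  have h := Real.exp_one_gt_d9
  have h4 : Real.exp 4 = Real.exp 1 ^ 4 := by rw [← Real.exp_nat_mul]; norm_num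
  rw [h4]
  have h' : (2.7182818283 : ℝ) ≤ Real.exp 1 := h.le
  calc (32 : ℝ) ≤ 2.7182818283 ^ 4 := by norm_num
    _ ≤ Real.exp 1 ^ 4 := by gcongr

/-- **Deep from an exit (PROVED).**  `β ≥ 0`, one cold torus of side `L ≥ 8` with `δᶜ_β(L) ≤ 1/24` ⇒ there is a scale `M ≥ 8`
beyond which EVERY cold torus has `δᶜ_β ≤ 2⁻²⁵`: the landed basin `abstractBasin_24_epsStar` gives a `2⁻²⁴`-exit at some
`L' ≥ 8`, the landed decay `decay_of_exit` gives `δᶜ_β(P) ≤ 2⁻²⁰e^{−(P+1)/L'} ≤ 2⁻²⁰e⁻⁴ ≤ 2⁻²⁵` for `P ≥ 4L'`. -/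
theorem deep_of_le24 (r : LatticeRep G) {β : ℝ} (hβ0 : 0 ≤ β) {L : ℕ} (hL : 8 ≤ L)
    (hδ : coldDefect r.ρ β L ≤ 1 / 24) :
    ∃ M : ℕ, 8 ≤ M ∧ ∀ P : ℕ, M ≤ P → coldDefect r.ρ β P ≤ 1 / 2 ^ 25 := by
  rw [coldDefect_eq_boxDefect] at hδ
  obtain ⟨L', hL', hδ'⟩ :=
    abstractBasin_24_epsStar _ (axisSymmetric r β) (tracePositive r hβ0) (volumeBounds r hβ0) L hL hδ
  rw [← coldDefect_eq_boxDefect, epsStar_eq] at hδ'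
  have hdec := decay_of_exit r hβ0 hL' hδ'
  refine ⟨4 * L', by omega, fun P hP => ?_⟩
  have h1 := hdec P (by omega)
  have hL'0 : (0 : ℝ) < L' := by exact_mod_cast (by omega : 0 < L')
  have hP' : (4 : ℝ) * L' ≤ P := by exact_mod_cast hP
  have hexp : Real.exp (-(((P : ℝ) + 1) / L')) ≤ Real.exp (-4) := by
    apply Real.exp_le_exp.mpr
    rw [neg_le_neg_iff, le_div_iff₀ hL'0]
    linarith
  calc coldDefect r.ρ β P ≤ ((2 : ℝ) ^ 20)⁻¹ * Real.exp (-(((P : ℝ) + 1) / L')) := h1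
    _ ≤ ((2 : ℝ) ^ 20)⁻¹ * (1 / 32) := by gcongr; exact hexp.trans exp_neg_four_le
    _ = 1 / 2 ^ 25 := by norm_num

end Model

/-! ## §3 Seams between the statements (PROVED) -/

/-- OH♯ ⇒ OH (a hypothesis on all scales `≥ L` is stronger than one on `[L, 4L]`). -/
theorem sharp_imp (h : ScalingHereditySharp) : ScalingHereditySC := by
  intro G _ _ _ _ hG hsc
  letI : MeasurableSpace G := borel G
  haveI : BorelSpace G := ⟨rfl⟩
  intro r
  obtain ⟨β₂, Δ, L₁, hΔ, hh⟩ := h G hG hsc r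
  exact ⟨β₂, Δ, L₁, hΔ, fun β hβ L hL hdeep β' h1 h2 =>
    hh β hβ L hL (fun L'' hL'' _ => hdeep L'' hL'') β' h1 h2⟩

/-- **OH(s) ⇒ OH_E** for every scale factor `s ≥ 1` (PROVED): the scale-free shadow.  Exit at `β` ⇒ deep at all scales
`≥ M` (`deep_of_le24`) ⇒ OH at `L := max L₁ M` ⇒ `δᶜ_{β'}(sL) ≤ 1/24` at `sL ≥ 8`. -/
theorem upward_of_scalingAt {s : ℕ} (hs : 1 ≤ s) (h : ScalingHeredityAt (1 / 2 ^ 25) (1 / 24) s) :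
    UpwardExitHereditySC := by
  intro G _ _ _ _ hG hsc
  letI : MeasurableSpace G := borel G
  haveI : BorelSpace G := ⟨rfl⟩
  intro r
  obtain ⟨β₂, Δ, L₁, hΔ, hh⟩ := h G hG hsc r
  refine ⟨max β₂ 0, Δ, hΔ, fun β hβ hex β' h1 h2 => ?_⟩
  have hββ₂ : β₂ ≤ β := le_trans (le_max_left _ _) hβ
  have hβ0 : 0 ≤ β := le_trans (le_max_right _ _) hβ
  obtain ⟨L, hL8, hδ⟩ := hex
  obtain ⟨M, hM8, hdeep⟩ := deep_of_le24 r hβ0 hL8 hδ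
  have h8 : 8 ≤ s * max L₁ M :=
    le_trans (le_trans hM8 (le_max_right L₁ M)) (Nat.le_mul_of_pos_left _ (by omega))
  refine ⟨s * max L₁ M, h8, ?_⟩
  exact hh β hββ₂ (max L₁ M) (le_max_left _ _)
    (fun L'' hL'' => hdeep L'' (le_trans (le_max_right _ _) hL'')) β' h1 h2

/-- **OH ⇒ OH_E** (PROVED; `s = 4`). -/
theorem upward_of_scaling (h : ScalingHereditySC) : UpwardExitHereditySC :=
  upward_of_scalingAt (s := 4) (by norm_num) h

/-- **The window induction (PROVED): OH_E ∧ K1 ⇒ E(1/24).**  From ONE exiting coupling `β₀ ≥ max β₂ 0` (K1), OH_E covers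
`[β₀+Δ, β₀+2Δ]`; inductively `[β₀+Δ, β₀+(n+2)Δ]` (step: `β' ↦ β := β' − Δ` is already covered); Archimedes finishes. -/
theorem coldExitAt_of_upward (hU : UpwardExitHereditySC) (hK : CofinalExitAt (1 / 24)) : ColdExitAt (1 / 24) := by
  intro G _ _ _ _ hG hsc
  letI : MeasurableSpace G := borel G
  haveI : BorelSpace G := ⟨rfl⟩
  intro r
  obtain ⟨β₂, Δ, hΔ, hher⟩ := hU G hG hsc r
  obtain ⟨β₀, hβ₀, L₀, hL₀, hδ₀⟩ := hK G hG hsc r (max β₂ 0)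
  have hβ₀₂ : β₂ ≤ β₀ := le_trans (le_max_left _ _) hβ₀
  have hQ : ∀ n : ℕ, ∀ β' : ℝ, β₀ + Δ ≤ β' → β' ≤ β₀ + ((n : ℝ) + 2) * Δ →
      ∃ L : ℕ, 8 ≤ L ∧ coldDefect r.ρ β' L ≤ 1 / 24 := by
    intro n
    induction n with
    | zero =>
      intro β' h1 h2
      exact hher β₀ hβ₀₂ ⟨L₀, hL₀, hδ₀⟩ β' h1 (by push_cast at h2; linarith)
    | succ n ih =>
      intro β' h1 h2
      push_cast at h2
      by_cases hc : β' ≤ β₀ + ((n : ℝ) + 2) * Δ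
      · exact ih β' h1 hc
      · have hc : β₀ + ((n : ℝ) + 2) * Δ < β' := lt_of_not_ge hc
        have hnΔ : 0 ≤ (n : ℝ) * Δ := mul_nonneg (Nat.cast_nonneg n) hΔ.le
        have hb1 : β₀ + Δ ≤ β' - Δ := by linarith
        have hb2 : β' - Δ ≤ β₀ + ((n : ℝ) + 2) * Δ := by linarith
        have hβ2' : β₂ ≤ β' - Δ := by linarith
        exact hher (β' - Δ) hβ2' (ih (β' - Δ) hb1 hb2) β' (by linarith) (by linarith)
  refine ⟨β₀ + Δ, fun β' hβ' => ?_⟩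
  obtain ⟨n, hn⟩ := exists_nat_ge ((β' - β₀) / Δ)
  have hn' : β' - β₀ ≤ (n : ℝ) * Δ := by rwa [div_le_iff₀ hΔ] at hn
  exact hQ n β' hβ' (by nlinarith [hΔ])

/-- E(1/24) ⇒ OH_E (trivially: every large coupling exits). -/
theorem upward_of_coldExitAt (hE : ColdExitAt (1 / 24)) : UpwardExitHereditySC := by
  intro G _ _ _ _ hG hsc
  letI : MeasurableSpace G := borel G
  haveI : BorelSpace G := ⟨rfl⟩
  intro r
  obtain ⟨β₁, hβ₁⟩ := hE G hG hsc r
  exact ⟨β₁, 1, one_pos, fun β hβ _ β' h1 _ => hβ₁ β' (by linarith)⟩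

/-- E(1/24) ⇒ K1(1/24) (trivially). -/
theorem cofinal_of_coldExitAt {θ : ℝ} (hE : ColdExitAt θ) : CofinalExitAt θ := by
  intro G _ _ _ _ hG hsc
  letI : MeasurableSpace G := borel G
  haveI : BorelSpace G := ⟨rfl⟩
  intro r β₁
  obtain ⟨β₀, hβ₀⟩ := hE G hG hsc r
  exact ⟨max β₀ β₁, le_max_right _ _, hβ₀ _ (le_max_left _ _)⟩

/-- **EXACT RE-CUT (PROVED; the K-probe).**  `OH_E ∧ K1(1/24) ↔ E(1/24)`.  So the scale-free content of the line is an
exact two-piece re-cut of E into «heredity across a coupling bracket» ∧ «one exit cofinally»; the registered load OH is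
STRICTLY more than its shadow OH_E only through the SCALE LAW (conclusion at `4L`, `L₁` uniform in `β`). -/
theorem recut_iff : (UpwardExitHereditySC ∧ CofinalExitAt (1 / 24)) ↔ ColdExitAt (1 / 24) :=
  ⟨fun h => coldExitAt_of_upward h.1 h.2, fun h => ⟨upward_of_coldExitAt h, cofinal_of_coldExitAt h⟩⟩

/-- **OH ∧ K1 ⇒ E(1/24)** (PROVED composition). -/
theorem coldExitAt_of_scaling (hOH : ScalingHereditySC) (hK : CofinalExitAt (1 / 24)) : ColdExitAt (1 / 24) :=
  coldExitAt_of_upward (upward_of_scaling hOH) hK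

/-! ## §4 Composition: the statements conclude the crux BY NAME (sorry-free given their hypotheses) -/

/-- **`IR_of_at`**: OH at any scale factor `s ≥ 1` → K1 → X → N → `Theses.BalabanLadder.IR` (`IR_of_exitAt24` is the landed bill). -/
theorem IR_of_at {s : ℕ} (hs : 1 ≤ s) (hOH : ScalingHeredityAt (1 / 2 ^ 25) (1 / 24) s) (hK : CofinalExitAt (1 / 24))
    (hX : AFToColdPressure) (hN : IRnsc) : Summit.QuantumFields.YangMills.Theses.BalabanLadder.IR :=
  IR_of_exitAt24 (coldExitAt_of_upward (upward_of_scalingAt hs hOH) hK) hX hN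

/-- **`IR_of`**: OH → K1 → X → N → `Theses.BalabanLadder.IR`. -/
theorem IR_of (hOH : ScalingHereditySC) (hK : CofinalExitAt (1 / 24)) (hX : AFToColdPressure) (hN : IRnsc) :
    Summit.QuantumFields.YangMills.Theses.BalabanLadder.IR :=
  IR_of_exitAt24 (coldExitAt_of_scaling hOH hK) hX hN

/-- OH♯-headed variant. -/
theorem IR_of_sharp (hOH : ScalingHereditySharp) (hK : CofinalExitAt (1 / 24)) (hX : AFToColdPressure) (hN : IRnsc) :
    Summit.QuantumFields.YangMills.Theses.BalabanLadder.IR :=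
  IR_of (sharp_imp hOH) hK hX hN

end Summit.QuantumFields.YangMills.Cruxes.IR.ScalingHeredity
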